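import Summits.SmoothPoincare4.SmoothPoincare4.Theses.SullivanDual
import Literature.Geometry.Symplectic.GromovR4StdModel
import Mathlib.Analysis.Calculus.BumpFunction.InnerProduct

/-!
# SmoothPoincare4 / SullivanDual — crux `Target` (stmt-SmoothPoincare4-7823), stub `stub_cutoff`

Smooth cut-off functions on a punctured smooth Hausdorff 4-manifold `M ∖ {p}` adapted to the
punctured chart-balls `B_ε = {x ≠ p | x ∈ (chartAt p).source, e x ∈ ball (e p) ε}`
(`e = extChartAt (𝓡 4) p`): for radii `0 < ε₁ < ε₂` with `closedBall (e p) ε₂ ⊆ e.target`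
there is a `C^∞` function `φ : M ∖ {p} → [0, 1]` with `φ = 0` on `B_{ε₁}` and `φ = 1` on a
neighbourhood of every point outside `B_{ε₂}`.

Construction.  Pick `ε₁ < r₁ < r₂ < ε₂` and a smooth bump `χ` on `ℝ⁴` centred at `e p` with
`χ = 1` on `closedBall (e p) r₁` and `χ = 0` off `ball (e p) r₂`; put `φ z = 1 - χ (e z)` for `z`
in the chart source and `φ z = 1` otherwise.  On the (open) punctured chart source `φ` is a `C^∞`
real function composed with the chart; off the compact set `e.symm '' closedBall (e p) r₂`
(which lies inside the chart source) `φ ≡ 1`.  This is the pattern of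
`SullivanDual.exists_contMDiff_eq_inversion_of_inPuncturedChartBall`.

References: F. W. Warner, GTM 94 (1983), 1.10–1.11 (bump functions) [WarnerGTM94].
-/

noncomputable section

-- the registered namespace `Summit.SmoothPoincare4.SmoothPoincare4.Theorems` repeats a component
set_option linter.dupNamespace false

open scoped Manifold ContDiff Topology
open Set Filter Metric
open Literature.Geometry.Kaehler Literature.Geometry.Symplectic

namespace Summit.SmoothPoincare4.SmoothPoincare4.Theorems

namespace SullivanDual

variable {M : Type*} [TopologicalSpace M] [T2Space M] [ChartedSpace (EuclideanSpace ℝ (Fin 4)) M]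
  [IsManifold (𝓡 4) ∞ M]

/-- **Stub D (cut-off functions adapted to punctured chart-balls).** For radii `0 < ε₁ < ε₂`
with the closed `ε₂`-ball inside the chart target there is a `C^∞` function `φ : M ∖ {p} → [0, 1]`
vanishing on the punctured chart-ball of radius `ε₁` and equal to `1` near every point outside
the punctured chart-ball of radius `ε₂`.  Construction: `φ = 1 - χ ∘ e` on the chart source,
`1` off it, with `χ` a smooth bump centred at `e p`, `χ = 1` on the closed `r₁`-ball, `χ = 0` off
the `r₂`-ball, `ε₁ < r₁ < r₂ < ε₂`. [folklore] -/
theorem stub_cutoff (p : M) (ε₁ ε₂ : ℝ) (h₁ : 0 < ε₁) (h₁₂ : ε₁ < ε₂)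
    (hball : Metric.closedBall (extChartAt (𝓡 4) p p) ε₂ ⊆ (extChartAt (𝓡 4) p).target) :
    ∃ φ : punctured p → ℝ, ContMDiff (𝓡 4) 𝓘(ℝ, ℝ) ∞ φ ∧
      (∀ x : punctured p, InPuncturedChartBall p ε₁ x → φ x = 0) ∧
      (∀ x : punctured p, ¬ InPuncturedChartBall p ε₂ x → ∀ᶠ z in 𝓝 x, φ z = 1) ∧
      (∀ x : punctured p, 0 ≤ φ x ∧ φ x ≤ 1) := by
  classical
  set e := extChartAt (𝓡 4) p with he
  set c : EuclideanSpace ℝ (Fin 4) := e p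
  -- radii `ε₁ < r₁ < r₂ < ε₂`
  obtain ⟨r₁, hr₁, hr₁'⟩ : ∃ r₁, ε₁ < r₁ ∧ r₁ < ε₂ := exists_between h₁₂
  obtain ⟨r₂, hr₂, hr₂'⟩ : ∃ r₂, r₁ < r₂ ∧ r₂ < ε₂ := exists_between hr₁'
  have hr₁pos : 0 < r₁ := h₁.trans hr₁
  -- the bump `χ = 1` on `closedBall c r₁`, `= 0` off `ball c r₂`
  let χ : ContDiffBump c := ⟨r₁, r₂, hr₁pos, hr₂⟩
  -- the cut-off: `1 - χ ∘ e` on the chart source, `1` off it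
  let φ : punctured p → ℝ := fun z =>
    if z.1 ∈ (chartAt (EuclideanSpace ℝ (Fin 4)) p).source then 1 - χ (e z.1) else 1
  -- the open punctured chart source and the compact region where `φ` may differ from `1`
  let U₀ : Set (punctured p) := Subtype.val ⁻¹' (chartAt (EuclideanSpace ℝ (Fin 4)) p).source
  have hU₀ : IsOpen U₀ :=
    (chartAt (EuclideanSpace ℝ (Fin 4)) p).open_source.preimage continuous_subtype_val
  have hRt : closedBall c r₂ ⊆ e.target := (closedBall_subset_closedBall hr₂'.le).trans hball
  let K : Set (punctured p) := Subtype.val ⁻¹' (e.symm '' closedBall c r₂)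
  have hK : IsClosed K := by
    have hcpt : IsCompact (e.symm '' closedBall c r₂) :=
      (isCompact_closedBall c r₂).image_of_continuousOn
        ((continuousOn_extChartAt_symm (I := 𝓡 4) p).mono hRt)
    exact hcpt.isClosed.preimage continuous_subtype_val
  have hKU : K ⊆ U₀ := by
    intro z hzK
    rw [Set.mem_preimage, Set.mem_image] at hzK
    obtain ⟨y, hy, hyz⟩ := hzK
    have h1 : e.symm y ∈ e.source := e.map_target (hRt hy)
    rw [hyz, he, extChartAt_source] at h1
    exact h1
  have hE : ContMDiffOn (𝓡 4) 𝓘(ℝ, EuclideanSpace ℝ (Fin 4)) ∞ (fun z : punctured p => e z.1) U₀ :=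
    (contMDiffOn_extChartAt (I := 𝓡 4) (x := p) (n := ∞)).comp
      (contMDiff_subtype_val (I := 𝓡 4) (n := ∞) (U := punctured p)).contMDiffOn
      (fun z hz => hz)
  -- `φ = 1` at points of the chart source whose chart image is at distance `≥ r₂` from `c`
  have hone' : ∀ w : punctured p, w.1 ∈ (chartAt (EuclideanSpace ℝ (Fin 4)) p).source →
      r₂ ≤ dist (e w.1) c → φ w = 1 := by
    intro w hws hfar
    have hχ0 : χ (e w.1) = 0 := χ.zero_of_le_dist hfar
    simp only [φ, if_pos hws, hχ0, sub_zero]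
  -- `φ = 1` off `K`
  have hone : ∀ w : punctured p, w ∉ K → φ w = 1 := by
    intro w hw
    by_cases hws : w.1 ∈ (chartAt (EuclideanSpace ℝ (Fin 4)) p).source
    · have hsrc : w.1 ∈ e.source := by rw [he, extChartAt_source]; exact hws
      have hfar : r₂ ≤ dist (e w.1) c :=
        not_lt.1 fun hlt =>
          hw (Set.mem_preimage.2 ⟨e w.1, mem_closedBall.2 hlt.le, e.left_inv hsrc⟩)
      exact hone' w hws hfar
    · simp only [φ, if_neg hws]
  refine ⟨φ, ?_, ?_, ?_, ?_⟩
  · -- smoothness, pointwise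
    intro z
    by_cases hz : z ∈ U₀
    · -- on the punctured chart source `φ = (1 - χ) ∘ e`, a smooth composition
      have hΨ : ContDiffAt ℝ ∞ (fun y : EuclideanSpace ℝ (Fin 4) => (1 : ℝ) - χ y) (e z.1) :=
        contDiffAt_const.sub χ.contDiffAt
      have hEz : ContMDiffAt (𝓡 4) 𝓘(ℝ, EuclideanSpace ℝ (Fin 4)) ∞
          (fun w : punctured p => e w.1) z :=
        (hE z hz).contMDiffAt (hU₀.mem_nhds hz)
      have hcomp : ContMDiffAt (𝓡 4) 𝓘(ℝ, ℝ) ∞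
          ((fun y : EuclideanSpace ℝ (Fin 4) => (1 : ℝ) - χ y) ∘ fun w : punctured p => e w.1) z :=
        ContDiffAt.comp_contMDiffAt (f := fun w : punctured p => e w.1) (x := z) hΨ hEz
      refine hcomp.congr_of_eventuallyEq ?_
      filter_upwards [hU₀.mem_nhds hz] with w hw
      have hws : w.1 ∈ (chartAt (EuclideanSpace ℝ (Fin 4)) p).source := hw
      simp only [φ, Function.comp_apply, if_pos hws]
    · -- off the punctured chart source `φ = 1` near `z` (`K ⊆ U₀` is closed)
      have hzK : z ∉ K := fun hzK => hz (hKU hzK)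
      refine (contMDiffAt_const (c := (1 : ℝ))).congr_of_eventuallyEq ?_
      filter_upwards [hK.isOpen_compl.mem_nhds hzK] with w hw
      exact hone w hw
  · -- vanishing on the punctured chart-ball of radius `ε₁`
    intro x hx
    have hx1 : x.1 ∈ (chartAt (EuclideanSpace ℝ (Fin 4)) p).source := hx.1
    have hx2 : e x.1 ∈ ball c ε₁ := hx.2
    have hχ1 : χ (e x.1) = 1 :=
      χ.one_of_mem_closedBall (mem_closedBall.2 ((mem_ball.1 hx2).le.trans hr₁.le))
    simp only [φ, if_pos hx1, hχ1, sub_self]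
  · -- `φ = 1` near every point outside the punctured chart-ball of radius `ε₂`
    intro x hx
    by_cases hxs : x.1 ∈ (chartAt (EuclideanSpace ℝ (Fin 4)) p).source
    · have hxb : e x.1 ∉ ball c ε₂ := fun hb => hx ⟨hxs, hb⟩
      have hdist : ε₂ ≤ dist (e x.1) c := not_lt.1 fun h => hxb (mem_ball.2 h)
      -- the open set of points of the chart source with chart image off `closedBall c r₂`
      have hV : IsOpen {z : punctured p |
          z.1 ∈ (chartAt (EuclideanSpace ℝ (Fin 4)) p).source ∧ e z.1 ∈ (closedBall c r₂)ᶜ} := by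
        have h : IsOpen (e.source ∩ e ⁻¹' (closedBall c r₂)ᶜ) :=
          (continuousOn_extChartAt (I := 𝓡 4) p).isOpen_inter_preimage
            (isOpen_extChartAt_source (I := 𝓡 4) p) isClosed_closedBall.isOpen_compl
        rw [he, extChartAt_source] at h
        exact h.preimage continuous_subtype_val
      have hxV : x ∈ {z : punctured p |
          z.1 ∈ (chartAt (EuclideanSpace ℝ (Fin 4)) p).source ∧ e z.1 ∈ (closedBall c r₂)ᶜ} := by
        refine ⟨hxs, ?_⟩
        rw [Set.mem_compl_iff, mem_closedBall, not_le]
        exact hr₂'.trans_le hdist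
      filter_upwards [hV.mem_nhds hxV] with z hz
      have hz2 : r₂ < dist (e z.1) c := by
        have h2 := hz.2
        rw [Set.mem_compl_iff, mem_closedBall, not_le] at h2
        exact h2
      exact hone' z hz.1 hz2.le
    · have hxK : x ∉ K := fun hxK => hxs (hKU hxK)
      filter_upwards [hK.isOpen_compl.mem_nhds hxK] with w hw
      exact hone w hw
  · -- values in `[0, 1]`
    intro x
    by_cases hxs : x.1 ∈ (chartAt (EuclideanSpace ℝ (Fin 4)) p).source
    · simp only [φ, if_pos hxs]
      exact ⟨sub_nonneg.2 χ.le_one, sub_le_self _ χ.nonneg⟩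
    · simp only [φ, if_neg hxs]
      exact ⟨zero_le_one, le_rfl⟩

end SullivanDual

end Summit.SmoothPoincare4.SmoothPoincare4.Theorems

end
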